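import Summits.RiemannHypothesis.RiemannHypothesis.Theorems.SuzukiWindowsDoorExplicitOpNorm
import Summits.RiemannHypothesis.RiemannHypothesis.Theorems.SuzukiWindowFactorisation
import Literature.NumberTheory.LFunctions.SuzukiPhiFunctions

/-!
# SuzukiPhiExistence — Suzuki's integral equations (3.4) are uniquely solvable on every CONTRACTION WINDOW
# (column DBR; RH-FREE, ζ-free operator theory)

LINE 1 — LABEL: RH-FREE (K-general functional analysis + its instances for Suzuki's single-operator kernels `K_θ` on the
cell's KERNEL contraction windows); bears_on LADDER-RH B-P(P2)/(P3) (dictionary «clean window ⇒ canonical-system data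
exist»).  WHAT THIS IS NOT: no new clean window, no positivity, no statement about zeros of `ζ`; nothing here bears on
the truth of RH.

M. Suzuki, J. Funct. Anal. 281 (2021) 109116 = arXiv:1606.05726, §3.3 **Lemma 3.3**: for `ε ∈ {±1}` and `t` in a window
free of the eigenvalues `±1`, the integral equation
`X(x) + ε ∫_{(−∞,t]} K(x+y) X(y) dy = K(x+t)` (`x ≤ t`)                                                    (3.4)
has a unique solution in `L²(−∞,t)` (Fredholm alternative).  The tree's `Literature/…/SuzukiPhiFunctions`
(rh-columns-lit, p465440) types the solutions (`IsSuzukiPhiSolution K ε t X`) and the extension (3.7) (`suzukiPhiExt`)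
but deliberately leaves EXISTENCE and a.e.-UNIQUENESS as hypotheses (`∃ X, IsSuzukiPhiSolution …`, `huniq`).

THIS FILE discharges both hypotheses on every **contraction window** — a window half-width `t > 0` on which every
bounded operator `A` on `L²(−t,t)` with the kernel formula `(Aφ)(x) = ∫_{(−t,t)} K(x+y)φ(y)dy` a.e. has `‖A‖ < 1` (the
hypothesis shape of `Theorems/SuzukiWindowsDoorExplicitOpNorm`, rh-dbr-eng-3) — for ANY continuous real kernel `K`
vanishing on `(−∞,0]` and ANY real `ε` with `|ε| ≤ 1`:
* `exists_isSuzukiPhiSolution` — existence (Neumann series: `1 + ε𝖪[t]` is a unit of the Banach algebra of bounded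
  operators on `L²(−t,t)`, `Units.oneSub`; the `L²` solution class `X₀` is turned into the POINTWISE representative
  `X(x) = K(x+t) − ε∫_{(−t,t)}K(x+y)X₀(y)dy`, which satisfies (3.4) at every `x ≤ t` and vanishes on `(−∞,−t]`);
* `isSuzukiPhiSolution_ae_unique` — any two solutions agree a.e. on `(−∞,t]` (indeed everywhere on `(−∞,−t]`);
* `isSuzukiPhiSolution_suzukiPhiExt_of_contraction`, `eq_suzukiPhiExt_of_contraction` — hence the
  tree's `suzukiPhiExt K ε t` IS a solution and every solution equals it pointwise on `(−∞,t]` (choice-free).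
* INSTANCES for Suzuki's kernels `K_θ = limKernel θ` ([Su20] (1.4)): `exists_isSuzukiPhiSolution_limKernel` on every window
  `t ≤ T` with `h_θ(T) = ∫₀^{2T}(2T−u)K_θ(u)² du < 1`, and the explicit kernel windows of rh-dbr-eng-3
  (`θ = 12, t ≤ 1/2`; `θ = 20, t ≤ 21/25`; `θ = 40, t ≤ 8/5`).
The operator is the tree's `Literature.Analysis.OperatorTheory.exists_l2KernelOp` (Reed–Simon VI.23) for the Hankel kernel
`(x,y) ↦ K(x+y) ∈ L²((−t,t)²)` (`SuzukiWindowsDoorTempleGalerkin.memLp_winKernel`).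

References: [Su21] M. Suzuki, J. Funct. Anal. 281 (2021) 109116, §3.3 Lemma 3.3, (3.4)–(3.8); [Su20] M. Suzuki, ASPM 84
(2020) (1.4); M. Reed, B. Simon, *Methods of Modern Mathematical Physics I*, Thm VI.23.
-/

noncomputable section

-- D-0017: `Summit.<S>.<S>.…` is the designed namespace of a single-problem summit.
set_option linter.dupNamespace false

open MeasureTheory Set Filter Topology

namespace Summit.RiemannHypothesis.RiemannHypothesis.Theorems.SuzukiPhiExistence

open Literature.NumberTheory.LFunctions Literature.Analysis.OperatorTheory
open Summit.RiemannHypothesis.RiemannHypothesis.Theorems.SuzukiWindowsDoorTempleGalerkin (memLp_winKernel)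
open Summit.RiemannHypothesis.RiemannHypothesis.Theorems.SuzukiWindowsDoorExplicitOpNorm
open Summit.RiemannHypothesis.RiemannHypothesis.Theorems.SuzukiKernelSemigroup (limKernel_eq_zero_of_nonpos)

variable {K : ℝ → ℝ} {t ε : ℝ}

/-! ## §1 Kernel bookkeeping: for `x ≤ t` the `(−∞,t]`-integral lives on the window `(−t,t)` -/

/-- RH-FREE.  For a kernel vanishing on `(−∞,0]` and `x ≤ t`, the integral of `K(x+y)X(y)` over `(−∞,t]` equals the
integral over the window `(−t,t)` (the integrand vanishes for `y ≤ −t`; the endpoint `t` is null). -/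
theorem setIntegral_Iic_kernel_mul_eq (hK0 : ∀ u : ℝ, u ≤ 0 → K u = 0) {x : ℝ} (hx : x ≤ t) (X : ℝ → ℝ) :
    ∫ y in Iic t, K (x + y) * X y = ∫ y in Ioo (-t) t, K (x + y) * X y := by
  have h1 : ∫ y in Iic t, K (x + y) * X y = ∫ y in Ioc (-t) t, K (x + y) * X y := by
    refine setIntegral_eq_of_subset_of_forall_sdiff_eq_zero measurableSet_Iic Ioc_subset_Iic_self ?_
    intro y hy
    have hy' : y ≤ -t := by
      rcases hy with ⟨hy1, hy2⟩
      by_contra h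
      exact hy2 ⟨lt_of_not_ge h, hy1⟩
    rw [hK0 _ (by linarith), zero_mul]
  rw [h1]
  exact setIntegral_congr_set (Ioo_ae_eq_Ioc (μ := (volume : Measure ℝ))).symm

/-- RH-FREE.  For `x ≤ −t` the `(−∞,t]`-integral of `K(x+y)X(y)` vanishes. -/
theorem setIntegral_Iic_kernel_mul_eq_zero (hK0 : ∀ u : ℝ, u ≤ 0 → K u = 0) {x : ℝ} (hx : x ≤ -t) (X : ℝ → ℝ) :
    ∫ y in Iic t, K (x + y) * X y = 0 := by
  refine setIntegral_eq_zero_of_forall_eq_zero fun y hy ↦ ?_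
  rw [hK0 _ (by simp only [mem_Iic] at hy; linarith), zero_mul]

/-- RH-FREE.  For `x ≤ −t` the window integral of `K(x+y)X(y)` vanishes. -/
theorem setIntegral_Ioo_kernel_mul_eq_zero (hK0 : ∀ u : ℝ, u ≤ 0 → K u = 0) {x : ℝ} (hx : x ≤ -t) (X : ℝ → ℝ) :
    ∫ y in Ioo (-t) t, K (x + y) * X y = 0 := by
  refine setIntegral_eq_zero_of_forall_eq_zero fun y hy ↦ ?_
  rw [hK0 _ (by linarith [hy.2]), zero_mul]

/-- RH-FREE.  A solution of (3.4) equals `K(x+t)` — hence `0` for a kernel vanishing on `(−∞,0]` — at every `x ≤ −t`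
(`t ≥ 0`). -/
theorem isSuzukiPhiSolution_eq_zero_of_le_neg (hK0 : ∀ u : ℝ, u ≤ 0 → K u = 0) (ht : 0 ≤ t) {X : ℝ → ℝ}
    (hX : IsSuzukiPhiSolution K ε t X) {x : ℝ} (hx : x ≤ -t) : X x = 0 := by
  have h := hX.2 x (by linarith)
  rw [setIntegral_Iic_kernel_mul_eq_zero hK0 hx, hK0 _ (by linarith)] at h
  linarith

/-! ## §2 The window operator on `L²(−t,t)` and integrability on the window -/

/-- RH-FREE.  A function square-integrable on `(−∞,t]` is integrable against the bounded kernel on the window: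
`y ↦ K(x+y)X(y) ∈ L¹((−t,t))` (continuous `K`, `t > 0`). -/
theorem integrableOn_kernel_mul_Ioo (hK : Continuous K) {X : ℝ → ℝ}
    (hX : MemLp X 2 (volume.restrict (Ioo (-t) t))) (x : ℝ) :
    IntegrableOn (fun y ↦ K (x + y) * X y) (Ioo (-t) t) := by
  haveI : IsFiniteMeasure (volume.restrict (Ioo (-t) t)) := by infer_instance
  have hXi : Integrable X (volume.restrict (Ioo (-t) t)) := hX.integrable one_le_two
  obtain ⟨C, hC⟩ := (isCompact_Icc (a := x - t) (b := x + t)).exists_bound_of_continuousOn hK.continuousOn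
  refine hXi.bdd_mul (c := C) ((hK.comp (continuous_const.add continuous_id)).aestronglyMeasurable) ?_
  refine (ae_restrict_iff' measurableSet_Ioo).2 (Eventually.of_forall fun y hy ↦ ?_)
  exact hC (x + y) ⟨by linarith [hy.1], by linarith [hy.2]⟩

/-- RH-FREE.  … and on `(−∞,t]` (the integrand vanishes off the window), for `x ≤ t`. -/
theorem integrableOn_kernel_mul_Iic (hK : Continuous K) (hK0 : ∀ u : ℝ, u ≤ 0 → K u = 0)
    {X : ℝ → ℝ} (hX : MemLp X 2 (volume.restrict (Iic t))) {x : ℝ} (hx : x ≤ t) :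
    IntegrableOn (fun y ↦ K (x + y) * X y) (Iic t) := by
  have hX' : MemLp X 2 (volume.restrict (Ioo (-t) t)) :=
    hX.mono_measure (Measure.restrict_mono (fun y hy ↦ hy.2.le) le_rfl)
  have h1 : IntegrableOn (fun y ↦ K (x + y) * X y) (Ioc (-t) t) := by
    rw [IntegrableOn, ← Measure.restrict_congr_set (Ioo_ae_eq_Ioc (μ := (volume : Measure ℝ)))]
    exact integrableOn_kernel_mul_Ioo hK hX' x
  refine h1.of_forall_sdiff_eq_zero measurableSet_Iic fun y hy ↦ ?_
  have hy' : y ≤ -t := by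
    rcases hy with ⟨hy1, hy2⟩
    by_contra h
    exact hy2 ⟨lt_of_not_ge h, hy1⟩
  rw [hK0 _ (by linarith), zero_mul]

/-! ## §3 Existence on a contraction window -/

/-- **RH-FREE · EXISTENCE (Suzuki JFA21 Lemma 3.3 on a contraction window).**  Let `K` be continuous with `K = 0` on
`(−∞,0]`, `|ε| ≤ 1`, and suppose every bounded operator on `L²(−t,t)` with the kernel formula
`(Aφ)(x) = ∫_{(−t,t)}K(x+y)φ(y)dy` (a.e.) is a strict contraction.  Then (3.4) has a solution `X ∈ L²(−∞,t)`, satisfying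
the equation at EVERY `x ≤ t`. -/
theorem exists_isSuzukiPhiSolution (hK : Continuous K) (hK0 : ∀ u : ℝ, u ≤ 0 → K u = 0) (hε : |ε| ≤ 1)
    (hcontr : ∀ A : Lp ℝ 2 (volume.restrict (Ioo (-t) t)) →L[ℝ] Lp ℝ 2 (volume.restrict (Ioo (-t) t)),
      (∀ φ : Lp ℝ 2 (volume.restrict (Ioo (-t) t)),
        (A φ : ℝ → ℝ) =ᵐ[volume.restrict (Ioo (-t) t)] fun x => ∫ y in Ioo (-t) t, K (x + y) * φ y) → ‖A‖ < 1) :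
    ∃ X : ℝ → ℝ, IsSuzukiPhiSolution K ε t X := by
  set μ : Measure ℝ := volume.restrict (Ioo (-t) t) with hμ
  haveI : IsFiniteMeasure μ := by rw [hμ]; infer_instance
  -- the window operator
  obtain ⟨A, hA⟩ := exists_l2KernelOp (μ := μ) (memLp_winKernel hK t)
  have hnorm : ‖A‖ < 1 := hcontr A hA
  -- the right-hand side `x ↦ K(x+t)` as an element of `L²(−t,t)`
  obtain ⟨CK, hCK⟩ := (isCompact_Icc (a := (0 : ℝ)) (b := 2 * t)).exists_bound_of_continuousOn hK.continuousOn
  have hbm : MemLp (fun x : ℝ ↦ K (x + t)) 2 μ := by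
    have hae : AEStronglyMeasurable (fun x : ℝ ↦ K (x + t)) μ :=
      (hK.comp (continuous_id.add continuous_const)).aestronglyMeasurable
    have htop : MemLp (fun x : ℝ ↦ K (x + t)) ⊤ μ := by
      refine memLp_top_of_bound hae CK ?_
      rw [hμ]
      refine (ae_restrict_iff' measurableSet_Ioo).2 (Eventually.of_forall fun x hx ↦ ?_)
      exact hCK (x + t) ⟨by linarith [hx.1], by linarith [hx.2]⟩
    exact htop.mono_exponent le_top
  set b : Lp ℝ 2 μ := hbm.toLp _ with hb
  -- `1 + εA` is a unit (Neumann series)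
  set T : Lp ℝ 2 μ →L[ℝ] Lp ℝ 2 μ := ε • A with hT
  have hTn : ‖-T‖ < 1 := by
    rw [norm_neg, hT, norm_smul, Real.norm_eq_abs]
    calc |ε| * ‖A‖ ≤ 1 * ‖A‖ := mul_le_mul_of_nonneg_right hε (norm_nonneg _)
      _ = ‖A‖ := one_mul _
      _ < 1 := hnorm
  set u := Units.oneSub (-T) hTn with hu
  have huval : (u : Lp ℝ 2 μ →L[ℝ] Lp ℝ 2 μ) = 1 + T := by
    rw [hu, Units.val_oneSub, sub_neg_eq_add]
  set X₀ : Lp ℝ 2 μ := (↑u⁻¹ : Lp ℝ 2 μ →L[ℝ] Lp ℝ 2 μ) b with hX₀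
  have hsolve : X₀ + T X₀ = b := by
    have h1 : ((u : Lp ℝ 2 μ →L[ℝ] Lp ℝ 2 μ) * ↑u⁻¹) b = b := by
      rw [Units.mul_inv, one_apply_eq_self]
    rw [mul_apply_eq_comp, huval, add_apply, one_apply_eq_self] at h1
    rw [hX₀]
    exact h1
  -- a.e. form of the equation on the window
  have hae : ∀ᵐ x ∂μ, X₀ x + ε * ∫ y in Ioo (-t) t, K (x + y) * X₀ y = K (x + t) := by
    have h1 : (↑(X₀ + T X₀) : ℝ → ℝ) =ᵐ[μ] (b : ℝ → ℝ) := by rw [hsolve]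
    have h2 := Lp.coeFn_add X₀ (T X₀)
    have h3 : (↑(T X₀) : ℝ → ℝ) =ᵐ[μ] fun x ↦ ε * (A X₀ : ℝ → ℝ) x := by
      rw [hT, smul_apply]
      filter_upwards [Lp.coeFn_smul ε (A X₀)] with x hx
      rw [hx, Pi.smul_apply, smul_eq_mul]
    have h4 := hA X₀
    have h5 : (b : ℝ → ℝ) =ᵐ[μ] fun x ↦ K (x + t) := hbm.coeFn_toLp
    filter_upwards [h1, h2, h3, h4, h5] with x e1 e2 e3 e4 e5
    rw [← e5, ← e1, e2, Pi.add_apply, e3, e4]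
  -- the pointwise representative
  set X : ℝ → ℝ := fun x ↦ K (x + t) - ε * ∫ y in Ioo (-t) t, K (x + y) * X₀ y with hXdef
  have hXX₀ : (fun x ↦ X x) =ᵐ[μ] (X₀ : ℝ → ℝ) := by
    filter_upwards [hae] with x hx
    simp only [hXdef]
    linarith
  have hint : ∀ x : ℝ, ∫ y in Ioo (-t) t, K (x + y) * X y = ∫ y in Ioo (-t) t, K (x + y) * X₀ y := by
    intro x
    refine integral_congr_ae ?_
    filter_upwards [hXX₀] with y hy
    rw [hy]
  refine ⟨X, ?_, fun x hx ↦ ?_⟩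
  · -- `X ∈ L²((−∞,t])`: `X = 1_{(−t,t)} X₀` a.e. on `(−∞,t]`
    have hXμ : MemLp X 2 μ := (Lp.memLp X₀).ae_eq hXX₀.symm
    have hind : MemLp ((Ioo (-t) t).indicator X) 2 (volume.restrict (Iic t)) := by
      have hI : Ioo (-t) t ∩ Iic t = Ioo (-t) t := inter_eq_left.2 fun y hy ↦ (hy.2.le : y ≤ t)
      rw [memLp_indicator_iff_restrict measurableSet_Ioo, Measure.restrict_restrict measurableSet_Ioo, hI]
      exact hXμ
    refine hind.ae_eq ?_
    have hne : ∀ᵐ x ∂(volume : Measure ℝ), x ≠ t := by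
      have h0 : ({t} : Set ℝ)ᶜ ∈ ae (volume : Measure ℝ) := compl_mem_ae_iff.2 (measure_singleton t)
      filter_upwards [h0] with x hx
      simpa using hx
    filter_upwards [ae_restrict_mem measurableSet_Iic, ae_restrict_of_ae (s := Iic t) hne] with x hx hxt
    by_cases hxm : x ∈ Ioo (-t) t
    · rw [indicator_of_mem hxm]
    · rw [indicator_of_notMem hxm]
      have hxle : x ≤ -t := by
        by_contra h
        exact hxm ⟨lt_of_not_ge h, lt_of_le_of_ne hx hxt⟩
      show 0 = X x
      simp only [hXdef]
      rw [hK0 _ (by linarith), setIntegral_Ioo_kernel_mul_eq_zero hK0 hxle]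
      ring
  · -- the equation at every `x ≤ t`
    rw [setIntegral_Iic_kernel_mul_eq hK0 hx, hint x]
    simp only [hXdef]
    ring

/-! ## §4 Uniqueness on a contraction window -/

/-- **RH-FREE · UNIQUENESS (Suzuki JFA21 Lemma 3.3 on a contraction window).**  Under the hypotheses of
`exists_isSuzukiPhiSolution`, two solutions of (3.4) agree almost everywhere on `(−∞,t]` (they agree everywhere on
`(−∞,−t]`, and on the window their difference is annihilated by the unit `1 + ε𝖪[t]`). -/
theorem isSuzukiPhiSolution_ae_unique (hK : Continuous K) (hK0 : ∀ u : ℝ, u ≤ 0 → K u = 0) (ht : 0 ≤ t) (hε : |ε| ≤ 1)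
    (hcontr : ∀ A : Lp ℝ 2 (volume.restrict (Ioo (-t) t)) →L[ℝ] Lp ℝ 2 (volume.restrict (Ioo (-t) t)),
      (∀ φ : Lp ℝ 2 (volume.restrict (Ioo (-t) t)),
        (A φ : ℝ → ℝ) =ᵐ[volume.restrict (Ioo (-t) t)] fun x => ∫ y in Ioo (-t) t, K (x + y) * φ y) → ‖A‖ < 1)
    {X Y : ℝ → ℝ} (hX : IsSuzukiPhiSolution K ε t X) (hY : IsSuzukiPhiSolution K ε t Y) :
    X =ᵐ[volume.restrict (Iic t)] Y := by
  set μ : Measure ℝ := volume.restrict (Ioo (-t) t) with hμ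
  haveI : IsFiniteMeasure μ := by rw [hμ]; infer_instance
  obtain ⟨A, hA⟩ := exists_l2KernelOp (μ := μ) (memLp_winKernel hK t)
  have hnorm : ‖A‖ < 1 := hcontr A hA
  set T : Lp ℝ 2 μ →L[ℝ] Lp ℝ 2 μ := ε • A with hT
  have hTn : ‖-T‖ < 1 := by
    rw [norm_neg, hT, norm_smul, Real.norm_eq_abs]
    calc |ε| * ‖A‖ ≤ 1 * ‖A‖ := mul_le_mul_of_nonneg_right hε (norm_nonneg _)
      _ = ‖A‖ := one_mul _
      _ < 1 := hnorm
  set u := Units.oneSub (-T) hTn with hu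
  have huval : (u : Lp ℝ 2 μ →L[ℝ] Lp ℝ 2 μ) = 1 + T := by
    rw [hu, Units.val_oneSub, sub_neg_eq_add]
  -- the difference `D = X − Y`
  set D : ℝ → ℝ := fun x ↦ X x - Y x with hD
  have hDmem : MemLp D 2 (volume.restrict (Iic t)) := hX.1.sub hY.1
  have hDμ : MemLp D 2 μ := hDmem.mono_measure (Measure.restrict_mono (fun y hy ↦ (hy.2.le : y ≤ t)) le_rfl)
  -- the homogeneous equation for `D` at every `x ≤ t`, in window form
  have hDeq : ∀ x : ℝ, x ≤ t → D x + ε * ∫ y in Ioo (-t) t, K (x + y) * D y = 0 := by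
    intro x hx
    have e1 := hX.2 x hx
    have e2 := hY.2 x hx
    rw [setIntegral_Iic_kernel_mul_eq hK0 hx] at e1 e2
    have hXμ : MemLp X 2 μ := hX.1.mono_measure (Measure.restrict_mono (fun y hy ↦ (hy.2.le : y ≤ t)) le_rfl)
    have hYμ : MemLp Y 2 μ := hY.1.mono_measure (Measure.restrict_mono (fun y hy ↦ (hy.2.le : y ≤ t)) le_rfl)
    have hsub : ∫ y in Ioo (-t) t, K (x + y) * D y =
        (∫ y in Ioo (-t) t, K (x + y) * X y) - ∫ y in Ioo (-t) t, K (x + y) * Y y := by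
      rw [← integral_sub (integrableOn_kernel_mul_Ioo hK hXμ x) (integrableOn_kernel_mul_Ioo hK hYμ x)]
      refine integral_congr_ae (Eventually.of_forall fun y ↦ ?_)
      simp only [hD]
      ring
    rw [hsub]
    simp only [hD]
    linarith
  -- the `L²` class of `D` is killed by the unit `1 + T`
  set d : Lp ℝ 2 μ := hDμ.toLp D with hd
  have hd_ae : (d : ℝ → ℝ) =ᵐ[μ] D := hDμ.coeFn_toLp
  have hkill : (u : Lp ℝ 2 μ →L[ℝ] Lp ℝ 2 μ) d = 0 := by
    rw [huval]
    refine Lp.ext ?_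
    have h2 := Lp.coeFn_add d (T d)
    have h3 : (↑(T d) : ℝ → ℝ) =ᵐ[μ] fun x ↦ ε * (A d : ℝ → ℝ) x := by
      rw [hT, smul_apply]
      filter_upwards [Lp.coeFn_smul ε (A d)] with x hx
      rw [hx, Pi.smul_apply, smul_eq_mul]
    have h4 := hA d
    have hint : ∀ x : ℝ, ∫ y in Ioo (-t) t, K (x + y) * d y = ∫ y in Ioo (-t) t, K (x + y) * D y := by
      intro x
      refine integral_congr_ae ?_
      filter_upwards [hd_ae] with y hy
      rw [hy]
    have hmem : ∀ᵐ x ∂μ, x ∈ Ioo (-t) t := by rw [hμ]; exact ae_restrict_mem measurableSet_Ioo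
    rw [add_apply, one_apply_eq_self]
    filter_upwards [h2, h3, h4, hd_ae, hmem, Lp.coeFn_zero (E := ℝ) (p := 2) (μ := μ)] with x e2 e3 e4 e5 hx e0
    rw [e2, Pi.add_apply, e3, e4, hint x, e5, e0, Pi.zero_apply]
    exact hDeq x hx.2.le
  have hd0 : d = 0 := by
    have h1 : ((↑u⁻¹ : Lp ℝ 2 μ →L[ℝ] Lp ℝ 2 μ) * (u : Lp ℝ 2 μ →L[ℝ] Lp ℝ 2 μ)) d = d := by
      rw [Units.inv_mul, one_apply_eq_self]
    rw [mul_apply_eq_comp, hkill, map_zero] at h1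
    exact h1.symm
  have hDae : ∀ᵐ x ∂μ, D x = 0 := by
    have h0 : (d : ℝ → ℝ) =ᵐ[μ] 0 := by rw [hd0]; exact Lp.coeFn_zero (E := ℝ) (p := 2) (μ := μ)
    filter_upwards [hd_ae, h0] with x e1 e2
    rw [← e1, e2, Pi.zero_apply]
  -- assemble on `(−∞,t] = (−∞,−t] ∪ (−t,t]`
  have hsplit : volume.restrict (Iic t) = volume.restrict (Iic (-t) ∪ Ioc (-t) t) := by
    rw [Iic_union_Ioc_eq_Iic (by linarith : -t ≤ t)]
  have hgoal : ∀ᵐ x ∂(volume.restrict (Iic t)), D x = 0 := by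
    rw [hsplit, ae_restrict_union_iff]
    constructor
    · refine (ae_restrict_iff' measurableSet_Iic).2 (Eventually.of_forall fun x hx ↦ ?_)
      simp only [hD]
      rw [isSuzukiPhiSolution_eq_zero_of_le_neg hK0 ht hX hx,
        isSuzukiPhiSolution_eq_zero_of_le_neg hK0 ht hY hx, sub_zero]
    · rw [← Measure.restrict_congr_set (Ioo_ae_eq_Ioc (μ := (volume : Measure ℝ)))]
      exact hDae
  filter_upwards [hgoal] with x hx
  simp only [hD] at hx
  exact sub_eq_zero.1 hx

/-! ## §5 Consequences for the tree's `suzukiPhiExt` -/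

/-- RH-FREE.  On a contraction window the tree's extended solution `suzukiPhiExt K ε t` ((3.7), built by choice from
SOME solution) IS a solution of (3.4). -/
theorem isSuzukiPhiSolution_suzukiPhiExt_of_contraction (hK : Continuous K) (hK0 : ∀ u : ℝ, u ≤ 0 → K u = 0)
    (hε : |ε| ≤ 1)
    (hcontr : ∀ A : Lp ℝ 2 (volume.restrict (Ioo (-t) t)) →L[ℝ] Lp ℝ 2 (volume.restrict (Ioo (-t) t)),
      (∀ φ : Lp ℝ 2 (volume.restrict (Ioo (-t) t)),
        (A φ : ℝ → ℝ) =ᵐ[volume.restrict (Ioo (-t) t)] fun x => ∫ y in Ioo (-t) t, K (x + y) * φ y) → ‖A‖ < 1) :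
    IsSuzukiPhiSolution K ε t (suzukiPhiExt K ε t) :=
  isSuzukiPhiSolution_suzukiPhiExt (exists_isSuzukiPhiSolution hK hK0 hε hcontr)

/-- **RH-FREE · CHOICE-FREENESS**: on a contraction window EVERY solution of (3.4) equals `suzukiPhiExt K ε t` at
every `x ≤ t` (the tree's `IsSuzukiPhiSolution.eq_suzukiPhiExt` with its uniqueness hypothesis discharged). -/
theorem eq_suzukiPhiExt_of_contraction (hK : Continuous K) (hK0 : ∀ u : ℝ, u ≤ 0 → K u = 0)
    (ht : 0 ≤ t) (hε : |ε| ≤ 1)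
    (hcontr : ∀ A : Lp ℝ 2 (volume.restrict (Ioo (-t) t)) →L[ℝ] Lp ℝ 2 (volume.restrict (Ioo (-t) t)),
      (∀ φ : Lp ℝ 2 (volume.restrict (Ioo (-t) t)),
        (A φ : ℝ → ℝ) =ᵐ[volume.restrict (Ioo (-t) t)] fun x => ∫ y in Ioo (-t) t, K (x + y) * φ y) → ‖A‖ < 1)
    {X : ℝ → ℝ} (hX : IsSuzukiPhiSolution K ε t X) {x : ℝ} (hx : x ≤ t) : X x = suzukiPhiExt K ε t x :=
  hX.eq_suzukiPhiExt (fun _ _ h1 h2 ↦ isSuzukiPhiSolution_ae_unique hK hK0 ht hε hcontr h1 h2) hx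

/-! ## §6 Instances: Suzuki's single-operator kernels `K_θ` on the cell's kernel contraction windows -/

/-- RH-FREE.  **`φ^±` for `K_θ` exist on every window `t ≤ T` with `h_θ(T) = ∫₀^{2T}(2T−u)K_θ(u)² du < 1`**
(the Hilbert–Schmidt contraction test of `SuzukiWindowsDoorExplicitOpNorm.opNorm_winOp_limKernel_lt_one`). -/
theorem exists_isSuzukiPhiSolution_limKernel {θ T : ℝ} (hθ : 1 < θ)
    (hT : ∫ u in (0 : ℝ)..(2 * T), (2 * T - u) * limKernel θ u ^ 2 < 1) (htT : t ≤ T) (hε : |ε| ≤ 1) :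
    ∃ X : ℝ → ℝ, IsSuzukiPhiSolution (limKernel θ) ε t X :=
  exists_isSuzukiPhiSolution (Suzuki2020_thm12_continuous hθ) (fun _ hu ↦ limKernel_eq_zero_of_nonpos hθ hu) hε
    (fun _ hA ↦ opNorm_winOp_limKernel_lt_one hθ hT htT hA)

/-- RH-FREE.  … and any two solutions agree a.e. on `(−∞,t]`. -/
theorem isSuzukiPhiSolution_limKernel_ae_unique {θ T : ℝ} (hθ : 1 < θ)
    (hT : ∫ u in (0 : ℝ)..(2 * T), (2 * T - u) * limKernel θ u ^ 2 < 1) (ht : 0 ≤ t) (htT : t ≤ T) (hε : |ε| ≤ 1)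
    {X Y : ℝ → ℝ} (hX : IsSuzukiPhiSolution (limKernel θ) ε t X) (hY : IsSuzukiPhiSolution (limKernel θ) ε t Y) :
    X =ᵐ[volume.restrict (Iic t)] Y :=
  isSuzukiPhiSolution_ae_unique (Suzuki2020_thm12_continuous hθ) (fun _ hu ↦ limKernel_eq_zero_of_nonpos hθ hu) ht hε
    (fun _ hA ↦ opNorm_winOp_limKernel_lt_one hθ hT htT hA) hX hY

/-- RH-FREE.  **θ = 12**: Suzuki's `φ^±_t` for `K₁₂` exist for every `t ≤ 1/2` and `|ε| ≤ 1`
(rh-dbr-eng-3's kernel window `opNorm_winOp_limKernel_twelve_lt_one`). -/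
theorem exists_isSuzukiPhiSolution_limKernel_twelve (ht' : t ≤ 1 / 2) (hε : |ε| ≤ 1) :
    ∃ X : ℝ → ℝ, IsSuzukiPhiSolution (limKernel 12) ε t X :=
  exists_isSuzukiPhiSolution (Suzuki2020_thm12_continuous (by norm_num))
    (fun _ hu ↦ limKernel_eq_zero_of_nonpos (by norm_num) hu) hε
    (fun _ hA ↦ opNorm_winOp_limKernel_twelve_lt_one ht' hA)

/-- RH-FREE.  **θ = 20**: Suzuki's `φ^±_t` for `K₂₀` exist for every `t ≤ 21/25` and `|ε| ≤ 1`. -/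
theorem exists_isSuzukiPhiSolution_limKernel_twenty (ht' : t ≤ 21 / 25) (hε : |ε| ≤ 1) :
    ∃ X : ℝ → ℝ, IsSuzukiPhiSolution (limKernel 20) ε t X :=
  exists_isSuzukiPhiSolution (Suzuki2020_thm12_continuous (by norm_num))
    (fun _ hu ↦ limKernel_eq_zero_of_nonpos (by norm_num) hu) hε
    (fun _ hA ↦ opNorm_winOp_limKernel_twenty_lt_one ht' hA)

/-- RH-FREE.  **θ = 40**: Suzuki's `φ^±_t` for `K₄₀` exist for every `t ≤ 8/5` and `|ε| ≤ 1`. -/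
theorem exists_isSuzukiPhiSolution_limKernel_forty (ht' : t ≤ 8 / 5) (hε : |ε| ≤ 1) :
    ∃ X : ℝ → ℝ, IsSuzukiPhiSolution (limKernel 40) ε t X :=
  exists_isSuzukiPhiSolution (Suzuki2020_thm12_continuous (by norm_num))
    (fun _ hu ↦ limKernel_eq_zero_of_nonpos (by norm_num) hu) hε
    (fun _ hA ↦ opNorm_winOp_limKernel_forty_lt_one ht' hA)

end Summit.RiemannHypothesis.RiemannHypothesis.Theorems.SuzukiPhiExistence

end
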